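/-
Copyright: the b2b-balaban T⁴-continuum CRUX team, row NE7b OWNER lineage `t4-ne7b-p1` (gen 139). Project licence.
-/
import Summits.QuantumFields.BalabanUV.T4Continuum.Spine.NE7b.SupBlockCovarianceKernelLetter

/-!
# THE OUTPUT HESSIAN'S ENTRYWISE MAJORANT — the letter that iterates (SCOPING (d11)(2)): by (439) the output Hessian's entry splits as
# `HessW(ψ)[e_x,e_y] = A_{xy}(ψ) − C_{xy}(ψ)` (tilted average of the input Hessian entry minus the tilted covariance of the gradient components).
# The AVERAGE keeps any entrywise majorant of the input (`|A_{xy}| ≤ sup_φ|U″(φ)[e_x,e_y]| ≤ Hk_{yx}`), and (447)'s ENTRY form of Dobrushin's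
# estimate bounds the covariance by the two Dobrushin profiles: for every nonnegative `D` with `I + D·C ≤ D`,
#   `|C_{xy}(ψ)| ≤ Σ_w (DᵀHd_x)_w·(DᵀHd_y)_w ∕ c_w`   (`Hd_x = (κd at x, H_{x·} off x)`, `c_w = M_{ww} − lam`),
# hence the OUTPUT ENTRY MAJORANT `|HessW(ψ)[e_x,e_y]| ≤ Hk_{yx} + Σ_w (DᵀHd_x)_w(DᵀHd_y)_w∕c_w`, uniform in `ψ` and the volume — with the
# Neumann `D` of (448) or the weighted one of (453) it DECAYS off the diagonal; its row sums are (450)∕(452) (row NE7b, node U5c; (403),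
# (437), (439), (447), (449), (450) BY NAME; [folklore])

Cell `pub-balaban`, sub-cell `t4`, spine estimate NE7b (`T4WeightBudget.RelWeightBound`; the cell's OWN estimate — NOT PRINTED in
[Bałaban 1983–89], NOT PROVED).  Crux-route work under `Spine/NE7b/` by the row OWNER (`t4-ne7b-p1` gen 139, file (454)) under FREEZE
(0)'s crux-prover clause; NOTHING of Bałaban's is named as a Lean object, valued or asserted; no `T4Continuum/Support` leaf typed; no
`def`, no notation; zero `sorry`.  Imports (BY NAME): the OWNER's (450) `…SupBlockCovarianceKernelLetter` (`tilted_integral_eq_gauss`,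
`integrable_lebesgue_of_gauss`), (449) (`tilted_line_hasDerivAt`, `tilted_floor`, `tilted_ceiling`, `tilted_cross`, `tilted_continuous`,
`gradient_obs_lipVec`), (447) (`abs_cov_le_kernel_gibbs`), (439) (`hessian_entry_split`), (437) (`rowsum_of_weighted_average`,
`integrable_weighted_hessian_entry`), (403) (`hessian_block_neg_log_apply`), (410) (`block_Z_pos`).

WHAT IS PROVED ([folklore]; `M ≻ 0`, `Γ = M⁻¹`, (439)'s class hypotheses, first-order letters `lam, κd, H`, any `D ≥ 0` with `I + D·C ≤ D`):
* §1 `tilted_average_entry_le` (`|A_{xy}(ψ)| ≤ Hk_{yx}` for an entrywise majorant `|U″(φ)[e_z][e_x]| ≤ Hk_{xz}`).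
* §2 **`gauss_cov_entry_le`** (`|C_{xy}(ψ)| ≤ Σ_w (DᵀHd_x)_w(DᵀHd_y)_w∕c_w`, (439)'s format).
* §3 THE END **`block_hessian_entry_le`** (`|HessW(ψ)[e_x,e_y]| ≤ Hk_{yx} + Σ_w (DᵀHd_x)_w(DᵀHd_y)_w∕c_w`).

HONEST (what this is NOT).  Entrywise bookkeeping; the choice of `D` (plain Neumann (448): row letters only; weighted (453): decay `θ⁻¹`) and
the precision condition are inputs; third-order kernel letters are NOT touched ((d11)(4)).  Scalar skeleton ((A3), NC-NE7b-α UNRULED);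
nothing of Bałaban's asserted.  BY-NAME EFFECT ON THE WALL: NONE.  NE7b NOT PRINTED ∕ NOT PROVED; spine PROVED 0∕9; rung (B)+1 — the
programme's measures remain FINITE-torus statements; NOT the mass gap, NOT Clay.  HONEST DEPENDENCY: continuum YM on T⁴ ⇐ BetaPertH ∧ nine
spine estimates (0∕9 proved); BetaPertH ⇐ (D1) ∧ (D4) ∧ CAP+tail; G-an2-4 gates asym, D1 and NE2∕3∕4.
-/

set_option autoImplicit false
set_option maxSynthPendingDepth 2

noncomputable section

namespace Summit.QuantumFields.BalabanUV.T4Continuum.NE7b.SupBlockHessianEntryLetter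

open MeasureTheory ProbabilityTheory Real Set Function Finset Matrix
open scoped BigOperators
open SupBlockCovarianceKernelLetter (tilted_integral_eq_gauss integrable_lebesgue_of_gauss)
open SupTiltedCovarianceKernelLetter (tilted_line_hasDerivAt tilted_floor tilted_ceiling tilted_cross tilted_continuous gradient_obs_lipVec)
open SupDobrushinCovarianceGibbs (abs_cov_le_kernel_gibbs)
open SupBlockHessianKernelSplit (hessian_entry_split)
open SupBlockHessianKernelAverage (rowsum_of_weighted_average integrable_weighted_hessian_entry)
open SupBlockEffectiveActionCovariance (hessian_block_neg_log_apply)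
open SupBlockDressedStep (block_Z_pos)
open SupBlockEffectiveActionDerivative (integrable_exp_neg_block)
open SupGaussianRegulator (transpose_eq_of_posSemidef)

variable {ι : Type} [Fintype ι] [DecidableEq ι]

variable {M : Matrix ι ι ℝ} {γop : ℝ} {U : EuclideanSpace ℝ ι → ℝ} {U' : EuclideanSpace ℝ ι → EuclideanSpace ℝ ι →L[ℝ] ℝ}
  {U'' : EuclideanSpace ℝ ι → EuclideanSpace ℝ ι →L[ℝ] EuclideanSpace ℝ ι →L[ℝ] ℝ} {κ₀ κ₁ κ₂ κr a τ δ θ : ℝ}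
  {ψ : EuclideanSpace ℝ ι} {lam κd mM γ : ℝ} {H Hk D : ι → ι → ℝ}

/-! ## §1. The tilted average keeps an entrywise majorant -/

/-- `2κ₀(1+τ)γ_op ≤ θ` from the regulator with `4δ` room. [folklore] -/
theorem regulator_drop (hκ₀ : 0 ≤ κ₀) (hτ : 0 < τ) (hδ : 0 < δ) (hθ0 : 0 < θ) (hκθ : (2 * κ₀ * (1 + τ) + 4 * δ) * γop ≤ θ) :
    2 * κ₀ * (1 + τ) * γop ≤ θ := by
  rcases le_or_gt 0 γop with h | h
  · have : 2 * κ₀ * (1 + τ) * γop ≤ (2 * κ₀ * (1 + τ) + 4 * δ) * γop := mul_le_mul_of_nonneg_right (by linarith) h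
    linarith
  · have : 2 * κ₀ * (1 + τ) * γop ≤ 0 := mul_nonpos_of_nonneg_of_nonpos (by positivity) h.le
    linarith

/-- **`|A_{xy}(ψ)| ≤ Hk_{yx}`**: the tilted average of the input's Hessian entry is bounded by any uniform entrywise majorant
`|U″(φ)[e_z][e_x]| ≤ Hk_{xz}` ((437)'s weighted-average lemma on a one-point index). [folklore] -/
theorem tilted_average_entry_le (hM : M.PosDef) (hΓop : (γop • (1 : Matrix ι ι ℝ) - M⁻¹).PosSemidef) (Y : Finset ι)
    (hUd : ∀ φ : EuclideanSpace ℝ ι, HasFDerivAt U (U' φ) φ) (hU''c : Continuous U'') (hκ₀ : 0 ≤ κ₀) (hτ : 0 < τ) (hδ : 0 < δ)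
    (hθ0 : 0 < θ) (hθ1 : θ < 1) (hκθ : (2 * κ₀ * (1 + τ) + 4 * δ) * γop ≤ θ)
    (hstab : ∀ φ : EuclideanSpace ℝ ι, -(κ₀ * ∑ x ∈ Y, φ x ^ 2) ≤ U φ) (hU''b : ∀ φ : EuclideanSpace ℝ ι, ‖U'' φ‖ ≤ κ₂)
    (hHk : ∀ (φ : EuclideanSpace ℝ ι) (x z : ι), |U'' φ (EuclideanSpace.single z (1 : ℝ)) (EuclideanSpace.single x (1 : ℝ))| ≤ Hk x z)
    (ψ : EuclideanSpace ℝ ι) (x y : ι) :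
    |(∫ ω : EuclideanSpace ℝ ι, exp (-U (ω + ψ)) ∂(multivariateGaussian 0 M⁻¹))⁻¹ * ∫ ω : EuclideanSpace ℝ ι, exp (-U (ω + ψ)) * U'' (ω + ψ) (EuclideanSpace.single x (1 : ℝ)) (EuclideanSpace.single y (1 : ℝ)) ∂(multivariateGaussian 0 M⁻¹)| ≤ Hk y x := by
  have hΓ : (M⁻¹).PosSemidef := hM.inv.posSemidef
  have hUc : Continuous U := continuous_iff_continuousAt.2 fun φ => (hUd φ).continuousAt
  have hZ := block_Z_pos hΓ hΓop Y hUd hκ₀ hτ hδ hθ0 hθ1 hκθ hstab ψ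
  have hI0 := integrable_exp_neg_block hΓ hΓop Y hUc.measurable hκ₀ hτ hθ1 (regulator_drop hκ₀ hτ hδ hθ0 hκθ) hstab ψ
  have hint := integrable_weighted_hessian_entry hΓ hΓop Y hUd hU''c hκ₀ hτ hδ hθ0 hθ1 hκθ hstab hU''b ψ x y
  have h := rowsum_of_weighted_average (multivariateGaussian 0 M⁻¹) (fun ω : EuclideanSpace ℝ ι => exp (-U (ω + ψ)))
    (fun (ω : EuclideanSpace ℝ ι) (_ : Unit) (_ : Unit) => U'' (ω + ψ) (EuclideanSpace.single x (1 : ℝ)) (EuclideanSpace.single y (1 : ℝ)))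
    (fun ω => (exp_pos _).le) hI0 hZ (fun _ _ => hint) (fun ω _ => by simpa using hHk (ω + ψ) y x) ()
  simpa using h

/-! ## §2. The covariance entry against the two Dobrushin profiles -/

/-- **`|C_{xy}(ψ)| ≤ Σ_w (DᵀHd_x)_w(DᵀHd_y)_w∕c_w`** in (439)'s format (`Γ = M⁻¹`): (447)'s entry estimate for the gradient components
through (449)'s structural letters and (450)'s bridge, for every nonnegative `D` with `I + D·C ≤ D`. [folklore] -/
theorem gauss_cov_entry_le (hM : M.PosDef) (hUd : ∀ φ : EuclideanSpace ℝ ι, HasFDerivAt U (U' φ) φ)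
    (hUfloor : ∀ (x : ι) (φ : EuclideanSpace ℝ ι) (r : ℝ),
      -lam * r ^ 2 ≤ (U' (φ + r • EuclideanSpace.single x (1 : ℝ)) (EuclideanSpace.single x (1 : ℝ)) - U' φ (EuclideanSpace.single x (1 : ℝ))) * r)
    (hUceil : ∀ (x : ι) (φ : EuclideanSpace ℝ ι) (r : ℝ),
      |U' (φ + r • EuclideanSpace.single x (1 : ℝ)) (EuclideanSpace.single x (1 : ℝ)) - U' φ (EuclideanSpace.single x (1 : ℝ))| ≤ κd * |r|)
    (hUcross : ∀ (x w : ι) (φ : EuclideanSpace ℝ ι) (r : ℝ),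
      |U' (φ + r • EuclideanSpace.single w (1 : ℝ)) (EuclideanSpace.single x (1 : ℝ)) - U' φ (EuclideanSpace.single x (1 : ℝ))| ≤ H x w * |r|)
    (hH : ∀ x w, 0 ≤ H x w) (hMdiag : ∀ x, |M x x| ≤ mM) (hc : ∀ x, 0 < M x x - lam)
    (hrow : ∀ x, ∑ w, (if w = x then 0 else |M x w| + H x w) / (M x x - lam) ≤ γ) (hγ0 : 0 ≤ γ) (hγ1 : γ < 1)
    (hD : ∀ x y, 0 ≤ D x y) (hDC : ∀ x y, (if x = y then (1 : ℝ) else 0) + ∑ z, D x z * ((if y = z then 0 else |M z y| + H z y) / (M z z - lam)) ≤ D x y)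
    (hI0 : Integrable (fun ω : EuclideanSpace ℝ ι => exp (-U (ω + ψ))) (multivariateGaussian 0 M⁻¹))
    (hI2 : ∀ w, Integrable (fun ω : EuclideanSpace ℝ ι => exp (-U (ω + ψ)) * ω w ^ 2) (multivariateGaussian 0 M⁻¹)) (x y : ι) :
    |((∫ ω : EuclideanSpace ℝ ι, exp (-U (ω + ψ)) ∂(multivariateGaussian 0 M⁻¹))⁻¹ * (∫ ω : EuclideanSpace ℝ ι, exp (-U (ω + ψ)) * (U' (ω + ψ)
          (EuclideanSpace.single x (1 : ℝ)) * U' (ω + ψ) (EuclideanSpace.single y (1 : ℝ))) ∂(multivariateGaussian 0 M⁻¹)) - ((∫ ω : EuclideanSpace ℝ ι, exp (-U (ω + ψ))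
          ∂(multivariateGaussian 0 M⁻¹)) ^ 2)⁻¹ * ((∫ ω : EuclideanSpace ℝ ι, exp (-U (ω + ψ)) * U' (ω + ψ) (EuclideanSpace.single x (1 : ℝ)) ∂(multivariateGaussian 0 M⁻¹)) *
          (∫ ω : EuclideanSpace ℝ ι, exp (-U (ω + ψ)) * U' (ω + ψ) (EuclideanSpace.single y (1 : ℝ)) ∂(multivariateGaussian 0 M⁻¹))))| ≤
      ∑ w, (∑ z, D z w * (if z = x then κd else H x z)) * (∑ z, D z w * (if z = y then κd else H y z)) / (M w w - lam) := by
  have hMsym : M.IsSymm := transpose_eq_of_posSemidef hM.posSemidef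
  -- the moment letters in Lebesgue form
  have hV0 : Integrable (fun z : ι → ℝ => exp (-(1 / 2 * (z ⬝ᵥ (M *ᵥ z)) + U (WithLp.toLp 2 z + ψ)))) := by
    have h := integrable_lebesgue_of_gauss hM ψ (k := fun _ => (1 : ℝ)) (by simpa only [mul_one] using hI0)
    simpa only [one_mul] using h
  have hV2 : ∀ w, Integrable (fun z : ι → ℝ => z w ^ 2 * exp (-(1 / 2 * (z ⬝ᵥ (M *ᵥ z)) + U (WithLp.toLp 2 z + ψ)))) := fun w => by
    have h := integrable_lebesgue_of_gauss hM ψ (k := fun ω : EuclideanSpace ℝ ι => ω w ^ 2) (hI2 w)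
    simpa only [PiLp.toLp_apply] using h
  have hJ : ∀ x w, 0 ≤ (if w = x then (0 : ℝ) else |M x w| + H x w) := fun x w => by
    split_ifs
    · exact le_rfl
    · exact add_nonneg (abs_nonneg _) (hH x w)
  have h447 := abs_cov_le_kernel_gibbs
    (P := fun x F ω => (∫ s, F (update ω x s) * exp (-(1 / 2 * (update ω x s ⬝ᵥ (M *ᵥ update ω x s)) + U (WithLp.toLp 2 (update ω x s) + ψ)))) /
      ∫ s, exp (-(1 / 2 * (update ω x s ⬝ᵥ (M *ᵥ update ω x s)) + U (WithLp.toLp 2 (update ω x s) + ψ))))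
    (V := fun z => 1 / 2 * (z ⬝ᵥ (M *ᵥ z)) + U (WithLp.toLp 2 z + ψ))
    (V₁ := fun x z => (M *ᵥ z) x + U' (WithLp.toLp 2 z + ψ) (EuclideanSpace.single x (1 : ℝ)))
    (c := fun x => M x x - lam) (Cw := mM + κd) (J := fun x w => if w = x then 0 else |M x w| + H x w) (γ := γ) (D := D)
    (F := fun z => U' (WithLp.toLp 2 z + ψ) (EuclideanSpace.single x (1 : ℝ)))
    (G := fun z => U' (WithLp.toLp 2 z + ψ) (EuclideanSpace.single y (1 : ℝ)))
    (a := fun w => if w = x then κd else H x w) (b := fun w => if w = y then κd else H y w)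
    (fun _ _ _ => rfl) (fun x z => tilted_line_hasDerivAt hMsym hUd ψ x z) (fun x z s t => tilted_floor hUfloor ψ x z s t) hc
    (fun x z s t => tilted_ceiling hUceil hMdiag ψ x z s t)
    (fun x w hw z s t => by rw [if_neg hw]; exact tilted_cross hUcross ψ x w z s t)
    (tilted_continuous hUd ψ) hV0 hV2 hJ (fun x => by simp) hrow hγ0 hγ1 hD hDC
    (fun w z s t => gradient_obs_lipVec hUceil hUcross ψ x w z s t) (fun w z s t => gradient_obs_lipVec hUceil hUcross ψ y w z s t)
  rw [tilted_integral_eq_gauss hM ψ, tilted_integral_eq_gauss hM ψ, tilted_integral_eq_gauss hM ψ] at h447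
  simp only [WithLp.toLp_ofLp] at h447
  refine le_trans (le_of_eq ?_) h447
  congr 1
  ring

/-! ## §3. The output Hessian's entrywise majorant -/

/-- **THE OUTPUT ENTRY MAJORANT**: `|HessW(ψ)[e_x,e_y]| ≤ Hk_{yx} + Σ_w (DᵀHd_x)_w(DᵀHd_y)_w∕c_w` ((439)'s split, §1, §2). [folklore] -/
theorem block_hessian_entry_le (hM : M.PosDef) (hΓop : (γop • (1 : Matrix ι ι ℝ) - M⁻¹).PosSemidef) (Y : Finset ι)
    (hUd : ∀ φ : EuclideanSpace ℝ ι, HasFDerivAt U (U' φ) φ) (hU'd : ∀ φ : EuclideanSpace ℝ ι, HasFDerivAt U' (U'' φ) φ)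
    (hU''c : Continuous U'') (hκ₀ : 0 ≤ κ₀) (hκ₁ : 0 ≤ κ₁) (ha : 0 ≤ a) (hκ₂ : 0 ≤ κ₂) (hτ : 0 < τ) (hδ : 0 < δ) (hθ0 : 0 < θ) (hθ1 : θ < 1)
    (hκθ : (2 * κ₀ * (1 + τ) + 4 * δ) * γop ≤ θ) (hstab : ∀ φ : EuclideanSpace ℝ ι, -(κ₀ * ∑ x ∈ Y, φ x ^ 2) ≤ U φ)
    (hU'b : ∀ φ : EuclideanSpace ℝ ι, ‖U' φ‖ ≤ κ₁ * (a + ∑ x ∈ Y, φ x ^ 2)) (hU''b : ∀ φ : EuclideanSpace ℝ ι, ‖U'' φ‖ ≤ κ₂)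
    (hHk : ∀ (φ : EuclideanSpace ℝ ι) (x z : ι), |U'' φ (EuclideanSpace.single z (1 : ℝ)) (EuclideanSpace.single x (1 : ℝ))| ≤ Hk x z)
    (hUfloor : ∀ (x : ι) (φ : EuclideanSpace ℝ ι) (r : ℝ),
      -lam * r ^ 2 ≤ (U' (φ + r • EuclideanSpace.single x (1 : ℝ)) (EuclideanSpace.single x (1 : ℝ)) - U' φ (EuclideanSpace.single x (1 : ℝ))) * r)
    (hUceil : ∀ (x : ι) (φ : EuclideanSpace ℝ ι) (r : ℝ),
      |U' (φ + r • EuclideanSpace.single x (1 : ℝ)) (EuclideanSpace.single x (1 : ℝ)) - U' φ (EuclideanSpace.single x (1 : ℝ))| ≤ κd * |r|)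
    (hUcross : ∀ (x w : ι) (φ : EuclideanSpace ℝ ι) (r : ℝ),
      |U' (φ + r • EuclideanSpace.single w (1 : ℝ)) (EuclideanSpace.single x (1 : ℝ)) - U' φ (EuclideanSpace.single x (1 : ℝ))| ≤ H x w * |r|)
    (hH : ∀ x w, 0 ≤ H x w) (hMdiag : ∀ x, |M x x| ≤ mM) (hc : ∀ x, 0 < M x x - lam)
    (hrow : ∀ x, ∑ w, (if w = x then 0 else |M x w| + H x w) / (M x x - lam) ≤ γ) (hγ0 : 0 ≤ γ) (hγ1 : γ < 1)
    (hD : ∀ x y, 0 ≤ D x y) (hDC : ∀ x y, (if x = y then (1 : ℝ) else 0) + ∑ z, D x z * ((if y = z then 0 else |M z y| + H z y) / (M z z - lam)) ≤ D x y)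
    (hI0 : Integrable (fun ω : EuclideanSpace ℝ ι => exp (-U (ω + ψ))) (multivariateGaussian 0 M⁻¹))
    (hI2 : ∀ w, Integrable (fun ω : EuclideanSpace ℝ ι => exp (-U (ω + ψ)) * ω w ^ 2) (multivariateGaussian 0 M⁻¹)) (x y : ι) :
    |((∫ ω : EuclideanSpace ℝ ι, exp (-U (ω + ψ)) ∂(multivariateGaussian 0 M⁻¹))⁻¹ • (∫ ω : EuclideanSpace ℝ ι, exp (-U (ω + ψ)) • (U'' (ω + ψ) - (U' (ω +
        ψ)).smulRight (U' (ω + ψ))) ∂(multivariateGaussian 0 M⁻¹)) + (((∫ ω : EuclideanSpace ℝ ι, exp (-U (ω + ψ)) ∂(multivariateGaussian 0 M⁻¹)) ^ 2)⁻¹ • ∫ ω :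
        EuclideanSpace ℝ ι, exp (-U (ω + ψ)) • U' (ω + ψ) ∂(multivariateGaussian 0 M⁻¹)).smulRight (∫ ω : EuclideanSpace ℝ ι, exp (-U (ω + ψ)) • U' (ω + ψ)
        ∂(multivariateGaussian 0 M⁻¹))) (EuclideanSpace.single x (1 : ℝ)) (EuclideanSpace.single y (1 : ℝ))| ≤
      Hk y x + ∑ w, (∑ z, D z w * (if z = x then κd else H x z)) * (∑ z, D z w * (if z = y then κd else H y z)) / (M w w - lam) := by
  have hΓ : (M⁻¹).PosSemidef := hM.inv.posSemidef
  have h1 := tilted_average_entry_le hM hΓop Y hUd hU''c hκ₀ hτ hδ hθ0 hθ1 hκθ hstab hU''b hHk ψ x y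
  have h2 := gauss_cov_entry_le hM hUd hUfloor hUceil hUcross hH hMdiag hc hrow hγ0 hγ1 hD hDC hI0 hI2 x y
  rw [hessian_block_neg_log_apply hΓ hΓop Y hUd hU'd hU''c hκ₀ hκ₁ ha hκ₂ hτ hδ hθ1 hκθ hstab hU'b hU''b ψ _ _,
    hessian_entry_split hΓ hΓop Y hUd hU'd hU''c hκ₀ hκ₁ ha hκ₂ hτ hδ hθ0 hθ1 hκθ hstab hU'b hU''b ψ x y]
  exact (abs_sub _ _).trans (add_le_add h1 h2)

end Summit.QuantumFields.BalabanUV.T4Continuum.NE7b.SupBlockHessianEntryLetter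

end
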